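import Summits.AnomalousDissipation.AnomalousDissipation.Theorems.MomentParityQuarticTightnessStubWindowFubini

/-!
# Route MomentParity · crux `QuarticTightness` (stmt-AnomalousDissipation-14331), line `horizon-shooting`:
# converse of the packaging, part II — a loud bounded Galerkin-invariant law SHOOTS loud windows at every horizon

Support file of the line lead (prover-line-stmt-AnomalousDissipation-14331-0). The landed glue
`MomentParityQuarticTightness.stub_horizonKrylovBogoliubov` turns HORIZON LOUDNESS at `(f, ν, N)` (for every
horizon one mean-zero Galerkin datum in the absorbing ball with window work `≥ ε'T` and window energy `≤ E'T`)
into an `IsInvariantWitness`. This file proves the CONVERSE up to explicit constants, so that the open stub of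
the line (`stub_universalHorizonLoud`) is certified to be EXACTLY crux-sized — equivalent, force by force and
viscosity by viscosity, to the existence of loud bounded Galerkin-invariant laws:

Part I (`…StubWindowFubini.lean`): two-budget selection, semiflow invariance of invariant witnesses, window
Fubini. Here (part II): the energy / power observables of synthesised fields on the coefficient space
(continuity of the synthesis map into `L²`, time Cauchy–Schwarz by AM–GM) and
* `stub_horizonConverse` (registered stub of the line's skeleton, calibration section) — **THE CONVERSE**: an `IsInvariantWitness f ν N R E' ε'` (`ε' > 0`)
  yields, for EVERY horizon `T > 0`, a mean-zero Galerkin datum of order `N` in the absorbing ball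
  `‖a‖₂ ≤ ‖f‖₂/(4π²ν)` with window work `≥ (ε'/2)T` and window energy `≤ M T`, `M = (4‖f‖₂E'/ε')²` (any
  `M > 0` with `‖f‖₂E' ≤ (ε'/4)√M`): by invariance + Fubini the window functionals have means `∫(u,f)dμ = `
  dissipation `≥ ε'` and `∫‖u‖²dμ ≤ E'`, and Cauchy–Schwarz in time gives `X ≤ ‖f‖₂√Y` pointwise.

Sources: Krylov–Bogoliubov / invariant measures of the Galerkin approximations and the Liouville equation
(FMRT 2001, Ch. IV App. B.1); Tobasco–Goluskin–Doering 2018 §5 (max over invariant measures = sup over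
trajectories). No new definitions; no theorem here concludes a Theses decl.
-/

noncomputable section

-- `Summit.<Summit>.<Problem>` is the tree's mandated summit-side namespace (CONVENTIONS §2); for this
-- single-conjunct summit the two coincide, so the duplicate is deliberate.
set_option linter.dupNamespace false

namespace Summit.AnomalousDissipation.AnomalousDissipation.Theorems.MomentParityQuarticTightness

open MeasureTheory Filter Topology Set Function
open scoped ENNReal InnerProductSpace RealInnerProductSpace
open Literature.Analysis.FunctionSpaces Literature.Analysis.FunctionSpaces.Torus
open Literature.Analysis.FluidPDE Literature.Analysis.FluidPDE.Torus
open Summit.AnomalousDissipation.AnomalousDissipation.Theses.MomentParity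
open Summit.AnomalousDissipation.AnomalousDissipation.Theorems
open Summit.AnomalousDissipation.AnomalousDissipation.Theorems.QuarticGate.Negative
open Summit.AnomalousDissipation.AnomalousDissipation.Theorems.QuarticTightness.Negative

-- `T3 = T³`, `R3 = ℝ³`, `H3 = H`, `L2T3 = L²(T³; ℝ³)` (sibling crux's abbreviations).
open Summit.AnomalousDissipation.AnomalousDissipation.Theorems.CubicParityLoud.Negative (T3 R3 H3 L2T3)

/-! ## D. The observables on the coefficient space -/

/-- A real trigonometric polynomial whose coefficient at the frequency `0` vanishes has zero mean. [folklore] -/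
private theorem hasZeroMean_realTrigPoly_of_coeff_zero' {d : Type*} [Fintype d]
    (S : Finset (d → ℤ)) {c : (d → ℤ) → EuclideanSpace ℂ d} (hc0 : c 0 = 0) :
    Torus.HasZeroMean (Torus.realTrigPoly S c) := by
  unfold Torus.HasZeroMean
  simp_rw [Torus.realTrigPoly_apply_eq_sum]
  rw [integral_finsetSum _ fun k _ => ?_]
  · refine Finset.sum_eq_zero fun k _ => ?_
    have hi : Integrable (fun x : UnitAddTorus d => UnitAddTorus.mFourier k x • c k) volume :=
      ((UnitAddTorus.mFourier k).continuous.smul continuous_const).integrable_unitAddTorus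
    rw [ContinuousLinearMap.integral_comp_comm _ hi, integral_smul_const, Torus.integral_mFourier]
    by_cases hk : k = 0
    · subst hk; simp [hc0]
    · rw [if_neg hk, zero_smul, map_zero]
  · exact (EuclideanSpace.realPart.continuous.comp
      ((UnitAddTorus.mFourier k).continuous.smul continuous_const)).integrable_unitAddTorus

/-- **The synthesis map is continuous** into `L²(T³; ℝ³)`: `c ↦ [realTrigPoly S c̄]` is additive and bounded by
`#S · ‖c‖` (pointwise bound `Torus.norm_realTrigPoly_apply_le` on the probability space `T³`). [folklore] -/
private theorem continuous_toLp_realTrigPoly' (S : Finset (Fin 3 → ℤ)) :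
    Continuous fun c : ↥S → EuclideanSpace ℂ (Fin 3) =>
      ((Torus.memLp_realTrigPoly S (Torus.coeffExt S c) 2).toLp _ : L2T3) := by
  set Φ : (↥S → EuclideanSpace ℂ (Fin 3)) → L2T3 := fun c =>
    (Torus.memLp_realTrigPoly S (Torus.coeffExt S c) 2).toLp _ with hΦ
  have hadd : ∀ c c', Φ (c + c') = Φ c + Φ c' := by
    intro c c'
    simp only [hΦ]
    rw [← MemLp.toLp_add]
    exact MemLp.toLp_congr _ _ (Eventually.of_forall fun x => by
      rw [Torus.coeffExt_add, Torus.realTrigPoly_add])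
  have hbound : ∀ c, ‖Φ c‖ ≤ (S.card : ℝ) * ‖c‖ := by
    intro c
    have h1 : ∀ᵐ x ∂(volume : Measure T3), ‖(Φ c : T3 → R3) x‖ ≤ (S.card : ℝ) * ‖c‖ := by
      filter_upwards [MemLp.coeFn_toLp (Torus.memLp_realTrigPoly S (Torus.coeffExt S c) 2)]
        with x hx
      rw [hΦ, hx]
      refine (Torus.norm_realTrigPoly_apply_le _ _ x).trans ?_
      calc ∑ k ∈ S, ‖Torus.coeffExt S c k‖ ≤ ∑ _k ∈ S, ‖c‖ :=
            Finset.sum_le_sum fun k _ => Torus.norm_coeffExt_le c k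
        _ = (S.card : ℝ) * ‖c‖ := by rw [Finset.sum_const, nsmul_eq_mul]
    have h2 := Lp.norm_le_of_ae_bound (by positivity) h1
    have hμ : measureUnivNNReal (volume : Measure T3) = 1 := by
      simp [measureUnivNNReal]
    rwa [hμ, NNReal.coe_one, Real.one_rpow, one_mul] at h2
  exact AddMonoidHomClass.continuous_of_bound (AddMonoidHom.mk' Φ hadd) _ hbound

/-- The energy of a synthesised field is the squared `L²` norm of its class:
`∫ ‖realTrigPoly S c̄‖² = ‖[realTrigPoly S c̄]‖²`. [folklore] -/
private theorem integral_norm_sq_realTrigPoly_eq (S : Finset (Fin 3 → ℤ)) (c : ↥S → EuclideanSpace ℂ (Fin 3)) :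
    ∫ x, ‖Torus.realTrigPoly S (Torus.coeffExt S c) x‖ ^ 2 =
      ‖((Torus.memLp_realTrigPoly S (Torus.coeffExt S c) 2).toLp _ : L2T3)‖ ^ 2 := by
  rw [← Torus.integral_norm_sq_coe_eq]
  exact integral_congr_ae ((MemLp.coeFn_toLp (Torus.memLp_realTrigPoly S (Torus.coeffExt S c) 2)).mono
    fun x hx => by simp only [hx])

/-- The injected power of a synthesised field is the `L²` inner product with the force:
`∫ ⟪f, realTrigPoly S c̄⟫ = ⟪[f], [realTrigPoly S c̄]⟫`. [folklore] -/
private theorem integral_inner_realTrigPoly_eq {f : T3 → R3} (hf : MemLp f 2 volume) (S : Finset (Fin 3 → ℤ))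
    (c : ↥S → EuclideanSpace ℂ (Fin 3)) :
    ∫ x, ⟪f x, Torus.realTrigPoly S (Torus.coeffExt S c) x⟫_ℝ =
      ⟪(hf.toLp f : L2T3), ((Torus.memLp_realTrigPoly S (Torus.coeffExt S c) 2).toLp _ : L2T3)⟫_ℝ := by
  rw [MeasureTheory.L2.inner_def]
  exact integral_congr_ae (by
    filter_upwards [MemLp.coeFn_toLp hf, MemLp.coeFn_toLp (Torus.memLp_realTrigPoly S (Torus.coeffExt S c) 2)]
      with x hx hy
    rw [hx, hy])

/-- **Time Cauchy–Schwarz by AM–GM.** For a nonnegative `e` on `[0, T]`, interval-integrable, and `h` with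
`h ≤ F√e` pointwise, interval-integrable: `∫₀ᵀ h ≤ F √(T ∫₀ᵀ e)` (`F ≥ 0`, `T ≥ 0`). [folklore] -/
private theorem intervalIntegral_le_sqrt_mul {e h : ℝ → ℝ} {F T : ℝ} (hF : 0 ≤ F) (hT : 0 ≤ T)
    (he : IntervalIntegrable e volume 0 T) (hh : IntervalIntegrable h volume 0 T)
    (he0 : ∀ t ∈ Icc 0 T, 0 ≤ e t) (hle : ∀ t ∈ Icc 0 T, h t ≤ F * Real.sqrt (e t)) :
    ∫ t in (0 : ℝ)..T, h t ≤ F * Real.sqrt (T * ∫ t in (0 : ℝ)..T, e t) := by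
  set A : ℝ := ∫ t in (0 : ℝ)..T, e t with hA
  have hA0 : 0 ≤ A := intervalIntegral.integral_nonneg hT fun t ht => he0 t ht
  -- AM–GM with a free parameter `s > 0`: `√e ≤ e/(2s) + s/2`
  have hamgm : ∀ s : ℝ, 0 < s → ∫ t in (0 : ℝ)..T, h t ≤ F * (A / (2 * s) + T * s / 2) := by
    intro s hs
    have hpt : ∀ t ∈ Icc 0 T, h t ≤ F * (e t / (2 * s) + s / 2) := by
      intro t ht
      refine (hle t ht).trans (mul_le_mul_of_nonneg_left ?_ hF)
      have h1 : 0 ≤ (Real.sqrt (e t) - s) ^ 2 := sq_nonneg _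
      have h2 : Real.sqrt (e t) ^ 2 = e t := Real.sq_sqrt (he0 t ht)
      rw [div_add_div _ _ (by positivity) two_ne_zero, le_div_iff₀ (by positivity)]
      nlinarith
    calc ∫ t in (0 : ℝ)..T, h t ≤ ∫ t in (0 : ℝ)..T, F * (e t / (2 * s) + s / 2) :=
          intervalIntegral.integral_mono_on hT hh ((he.div_const _ |>.add (by simp)).const_mul F)
            fun t ht => hpt t ht
      _ = F * (A / (2 * s) + T * s / 2) := by
          rw [intervalIntegral.integral_const_mul, intervalIntegral.integral_add (he.div_const _) (by simp),
            intervalIntegral.integral_div, intervalIntegral.integral_const, smul_eq_mul, sub_zero, hA]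
          ring
  by_cases hAT : T * A = 0
  · -- degenerate window: let `s → 0⁺` along `s = δ`
    rw [hAT, Real.sqrt_zero, mul_zero]
    refine le_of_forall_pos_le_add fun δ hδ => ?_
    rcases mul_eq_zero.1 hAT with hT0 | hA00
    · -- `T = 0`
      subst hT0; simp [hδ.le]
    · have hF1 : 0 < F + 1 := by linarith
      have h := hamgm (δ / ((F + 1) * (T + 1))) (by positivity)
      rw [hA00, zero_div, zero_add] at h
      refine h.trans ?_
      rw [zero_add]
      have : F * (T * (δ / ((F + 1) * (T + 1))) / 2) = δ * (F / (F + 1)) * (T / (T + 1)) / 2 := by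
        field_simp
      rw [this]
      have h3 : F / (F + 1) ≤ 1 := (div_le_one hF1).2 (by linarith)
      have h4 : T / (T + 1) ≤ 1 := (div_le_one (by linarith)).2 (by linarith)
      have h5 : 0 ≤ F / (F + 1) := by positivity
      have h6 : 0 ≤ T / (T + 1) := by positivity
      nlinarith [mul_le_mul h3 h4 h6 zero_le_one]
  · -- optimal `s = √(A/T)`
    have hT0 : 0 < T := lt_of_le_of_ne hT (fun h => hAT (by rw [← h, zero_mul]))
    have hA00 : 0 < A := lt_of_le_of_ne hA0 (fun h => hAT (by rw [← h, mul_zero]))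
    set s : ℝ := Real.sqrt (A / T) with hs
    have hs0 : 0 < s := Real.sqrt_pos.2 (div_pos hA00 hT0)
    have h := hamgm s hs0
    have hs2 : s ^ 2 = A / T := Real.sq_sqrt (div_pos hA00 hT0).le
    have hkey : A / (2 * s) + T * s / 2 = Real.sqrt (T * A) := by
      have hsne : s ≠ 0 := hs0.ne'
      have hA' : A = T * s ^ 2 := by rw [hs2]; field_simp
      have hTA : Real.sqrt (T * A) = T * s := by
        rw [hA', show T * (T * s ^ 2) = (T * s) ^ 2 by ring, Real.sqrt_sq (by positivity)]
      rw [hTA, hA']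
      field_simp
      ring
    rw [hkey] at h
    exact h

/-! ## E. THE CONVERSE: a loud bounded Galerkin-invariant law shoots loud windows at every horizon -/

/-- **HORIZON LOUDNESS FROM AN INVARIANT WITNESS (the converse of `stub_horizonKrylovBogoliubov`, up to
constants).** Let `f` be smooth and mean-zero, `ν > 0`, `ε' > 0`, and `μ` an `IsInvariantWitness f ν N R E' ε'`
(level-`N`, bounded support, all-order stationary, energy `≤ E'`, dissipation `≥ ε'`). Then for every `M > 0` with
`‖f‖₂ E' ≤ (ε'/4) √M` and EVERY horizon `T > 0` there is a mean-zero Galerkin datum `a` of order `N` in the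
absorbing ball `‖a‖₂ ≤ ‖f‖₂/(4π²ν)` whose window has work `∫₀ᵀ (f, u_t) dt ≥ (ε'/2) T` and energy
`∫₀ᵀ ‖u_t‖₂² dt ≤ M T`. Proof: push `μ` to the phase space (`μ'`, invariant by §B, carried by the image of the
compact level ball intersected with the absorbing ball — `ae_norm_le_absorbing`); the window functionals
`X = T⁻¹∫₀ᵀ (f, u_t)`, `Y = T⁻¹∫₀ᵀ ‖u_t‖²` have `∫X dμ' = ∫(u,f)dμ = ` dissipation `≥ ε'` (energy row) and
`∫Y dμ' = ∫‖u‖²dμ ≤ E'` (§C), and `X ≤ ‖f‖₂√Y` along every orbit (Cauchy–Schwarz in space, AM–GM in time);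
the two-budget selection §A picks the datum. So, force by force and viscosity by viscosity, horizon loudness
with budgets `(E', ε')` ⇒ an invariant witness with `(E', ε')` (S7) ⇒ horizon loudness with budgets
`((4‖f‖₂E'/ε')², ε'/2)`: the open stub `stub_universalHorizonLoud` of the line is EXACTLY the universal
Galerkin-ensemble floor. [folklore] -/
theorem stub_horizonConverse {f : T3 → R3} (hfs : Torus.IsSmooth f)
    (hfz : Torus.HasZeroMean f) {ν : ℝ} (hν : 0 < ν) {N : ℕ} {R E' ε' : ℝ} (hε' : 0 < ε')
    {μ : Measure H3} (hw : IsInvariantWitness f ν N R E' ε' μ) {M : ℝ} (hM : 0 < M)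
    (hFE : Real.sqrt (∫ x, ‖f x‖ ^ 2) * E' ≤ ε' / 4 * Real.sqrt M) {T : ℝ} (hT : 0 < T) :
    ∃ a : T3 → R3, IsGalerkinMode N a ∧ Torus.HasZeroMean a ∧
      ∫ x, ‖a x‖ ^ 2 ≤ (Real.sqrt (∫ x, ‖f x‖ ^ 2) / (4 * Real.pi ^ 2 * ν)) ^ 2 ∧
      ε' / 2 * T ≤ ∫ t in (0 : ℝ)..T, ∫ x, ⟪f x, Torus.galerkinFlow ν f N t a x⟫_ℝ ∧
      ∫ t in (0 : ℝ)..T, ∫ x, ‖Torus.galerkinFlow ν f N t a x‖ ^ 2 ≤ M * T := by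
  have hflow := map_galerkinCoeffFlow_map_eq_of_isInvariantWitness hfs hfz hν hw
  obtain ⟨hp, hlev, hball, hinv, hE, hD⟩ := hw
  haveI := hp
  have hf2 : MemLp f 2 volume := hfs.memLp 2
  have hfi : Integrable f volume := hf2.integrable one_le_two
  have hS : ∀ k ∈ freqBall (d := Fin 3) N, -k ∈ freqBall (d := Fin 3) N := neg_mem_freqBall_of_mem
  have hg : IsRealCoeff (fourierRestrict (freqBall N) f) := isRealCoeff_mFourierCoeff hfi
  -- `‖f‖₂` as the norm of the class of `f`
  set F : ℝ := Real.sqrt (∫ x, ‖f x‖ ^ 2) with hFdef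
  have hF0 : 0 ≤ F := Real.sqrt_nonneg _
  have hFnorm : ‖(hf2.toLp f : L2T3)‖ = F := by
    have h1 : ∫ x, ‖f x‖ ^ 2 = ‖(hf2.toLp f : L2T3)‖ ^ 2 := by
      rw [← Torus.integral_norm_sq_coe_eq]
      exact integral_congr_ae ((MemLp.coeFn_toLp hf2).mono fun x hx => by simp only [hx])
    rw [hFdef, h1, Real.sqrt_sq (norm_nonneg _)]
  -- radii: the witness radius and the absorbing radius
  have hR : 0 ≤ R := by
    obtain ⟨u, hu⟩ := hball.exists
    exact (norm_nonneg u).trans hu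
  set Rν : ℝ := F / (4 * Real.pi ^ 2 * ν) with hRνdef
  have habs : ∀ᵐ u ∂μ, ‖u‖ ≤ Rν := by
    have h := GalerkinInvariantLoud.Negative.ae_norm_le_absorbing hν hf2 hlev hball hinv
    rwa [hFnorm] at h
  -- the compact carrier in `H` and the coefficient map
  set K : Set H3 := {u : H3 | IsLevel N u ∧ ‖u‖ ≤ R} with hKdef
  have hK : IsCompact K := MomentParityMomentClosure.isCompact_levelBall N hR
  have hμK : ∀ᵐ u ∂μ, u ∈ K := hlev.and hball
  set Tc : H3 → (↥(freqBall (d := Fin 3) N) → EuclideanSpace ℂ (Fin 3)) :=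
    fun u => fourierRestrict (freqBall N) (u.1 : T3 → R3) with hTc
  have hTc_cont : Continuous Tc := continuous_fourierRestrict_coe N
  have hTc_meas : Measurable Tc := hTc_cont.measurable
  set μ' := μ.map Tc with hμ'
  haveI : IsProbabilityMeasure μ' := Measure.isProbabilityMeasure_map hTc_meas.aemeasurable
  have hK' : IsCompact (Tc '' K) := hK.image hTc_cont
  have hK'V : Tc '' K ⊆ ((galerkinSubspace (freqBall (d := Fin 3) N) :
      Submodule ℝ (↥(freqBall (d := Fin 3) N) → EuclideanSpace ℂ (Fin 3))) :
        Set (↥(freqBall (d := Fin 3) N) → EuclideanSpace ℂ (Fin 3))) := by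
    rintro _ ⟨u, -, rfl⟩
    exact MomentParity.fourierRestrict_coe_mem_galerkinSubspace N u
  have hμ'K : μ' (Tc '' K)ᶜ = 0 := by
    rw [hμ', Measure.map_apply hTc_meas (hK'.isClosed.measurableSet.compl)]
    refine measure_mono_null (fun u hu hK => hu ⟨u, hK, rfl⟩) ?_
    exact mem_ae_iff.1 hμK
  -- synthesis, energy and power observables on the coefficient space
  set poly : (↥(freqBall (d := Fin 3) N) → EuclideanSpace ℂ (Fin 3)) → T3 → R3 :=
    fun c => Torus.realTrigPoly (freqBall N) (Torus.coeffExt (freqBall N) c) with hpoly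
  set Φ : (↥(freqBall (d := Fin 3) N) → EuclideanSpace ℂ (Fin 3)) → L2T3 :=
    fun c => (Torus.memLp_realTrigPoly (freqBall N) (Torus.coeffExt (freqBall N) c) 2).toLp _ with hΦdef
  have hΦc : Continuous Φ := continuous_toLp_realTrigPoly' (freqBall N)
  set e : (↥(freqBall (d := Fin 3) N) → EuclideanSpace ℂ (Fin 3)) → ℝ := fun c => ∫ x, ‖poly c x‖ ^ 2 with hedef
  set gpow : (↥(freqBall (d := Fin 3) N) → EuclideanSpace ℂ (Fin 3)) → ℝ :=
    fun c => ∫ x, ⟪f x, poly c x⟫_ℝ with hgdef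
  have he_eq : ∀ c, e c = ‖Φ c‖ ^ 2 := fun c => integral_norm_sq_realTrigPoly_eq (freqBall N) c
  have hg_eq : ∀ c, gpow c = ⟪(hf2.toLp f : L2T3), Φ c⟫_ℝ := fun c =>
    integral_inner_realTrigPoly_eq hf2 (freqBall N) c
  have he_cont : Continuous e := by
    have : e = fun c => ‖Φ c‖ ^ 2 := funext he_eq
    rw [this]; exact (hΦc.norm).pow 2
  have hg_cont : Continuous gpow := by
    have : gpow = fun c => ⟪(hf2.toLp f : L2T3), Φ c⟫_ℝ := funext hg_eq
    rw [this]; exact continuous_const.inner hΦc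
  have he0 : ∀ c, 0 ≤ e c := fun c => integral_nonneg fun x => by positivity
  have hg_le : ∀ c, gpow c ≤ F * Real.sqrt (e c) := by
    intro c
    rw [hg_eq, he_eq, Real.sqrt_sq (norm_nonneg _), ← hFnorm]
    exact real_inner_le_norm _ _
  -- on level-`N` classes the synthesis of the coefficients recovers the class
  have hpolyT : ∀ u : H3, IsLevel N u → ((u : L2T3) : T3 → R3) =ᵐ[volume] poly (Tc u) := fun u hu =>
    MomentParity.coe_ae_eq_realTrigPoly u hu
  have he_T : ∀ u : H3, IsLevel N u → e (Tc u) = ‖u‖ ^ 2 := by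
    intro u hu
    have h1 : ‖u‖ = ‖((u : L2T3))‖ := rfl
    rw [h1, ← Torus.integral_norm_sq_coe_eq]
    exact integral_congr_ae ((hpolyT u hu).mono fun x hx => by simp only [hx])
  have hg_T : ∀ u : H3, IsLevel N u → gpow (Tc u) = Torus.pairing u.1 f := by
    intro u hu
    unfold Torus.pairing
    exact integral_congr_ae ((hpolyT u hu).mono fun x hx => by
      show ⟪f x, poly (Tc u) x⟫_ℝ = ⟪((u : L2T3) : T3 → R3) x, f x⟫_ℝ
      rw [← hx, real_inner_comm])
  -- means of the observables under `μ'`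
  have h2 : Integrable (fun u : H3 => ‖u‖ ^ 2) μ := integrable_norm_pow_of_ae_le hball 2
  have hmean_e : ∫ c, e c ∂μ' ≤ E' := by
    rw [hμ', integral_map hTc_meas.aemeasurable he_cont.aestronglyMeasurable]
    calc ∫ u, e (Tc u) ∂μ = ∫ u, ‖u‖ ^ 2 ∂μ :=
          integral_congr_ae (hlev.mono fun u hu => he_T u hu)
      _ ≤ E' := hE
  have hmean_g : ε' ≤ ∫ c, gpow c ∂μ' := by
    rw [hμ', integral_map hTc_meas.aemeasurable hg_cont.aestronglyMeasurable]
    calc ε' ≤ Torus.ensembleDissipation ν μ := hD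
      _ = ∫ u, Torus.pairing u.1 f ∂μ :=
          ensembleDissipation_eq_of_polyStationary f hf2 hlev h2 le_rfl (fun m g P hg' _ => hinv m g P hg')
      _ = ∫ u, gpow (Tc u) ∂μ := (integral_congr_ae (hlev.mono fun u hu => hg_T u hu)).symm
  -- the window functionals and their means (Fubini + invariance)
  set ϕ : ℝ → (↥(freqBall (d := Fin 3) N) → EuclideanSpace ℂ (Fin 3)) →
      (↥(freqBall (d := Fin 3) N) → EuclideanSpace ℂ (Fin 3)) :=
    fun t c => galerkinCoeffFlow ν (fourierRestrict (freqBall N) f) t c with hϕdef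
  obtain ⟨hXi, hXmean⟩ := stub_windowFubini hν.le hS hg hK' hK'V hμ'K hflow hg_cont hT
  obtain ⟨hYi, hYmean⟩ := stub_windowFubini hν.le hS hg hK' hK'V hμ'K hflow he_cont hT
  set X : (↥(freqBall (d := Fin 3) N) → EuclideanSpace ℂ (Fin 3)) → ℝ :=
    fun c => T⁻¹ * ∫ t in (0 : ℝ)..T, gpow (ϕ t c) with hXdef
  set Y : (↥(freqBall (d := Fin 3) N) → EuclideanSpace ℂ (Fin 3)) → ℝ :=
    fun c => T⁻¹ * ∫ t in (0 : ℝ)..T, e (ϕ t c) with hYdef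
  have hXint : ε' ≤ ∫ c, X c ∂μ' := by
    rw [hXdef]
    simp only []
    rw [integral_const_mul, hXmean, ← mul_assoc, inv_mul_cancel₀ hT.ne', one_mul]
    exact hmean_g
  have hYint : ∫ c, Y c ∂μ' ≤ E' := by
    rw [hYdef]
    simp only []
    rw [integral_const_mul, hYmean, ← mul_assoc, inv_mul_cancel₀ hT.ne', one_mul]
    exact hmean_e
  -- orbits from the carrier are continuous, so `Y ≥ 0` and `X ≤ F √Y` there
  have hμ'K' : ∀ᵐ c ∂μ', c ∈ Tc '' K :=
    (measure_eq_zero_iff_ae_notMem.1 hμ'K).mono fun c hc => by simpa using hc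
  have horbit : ∀ c ∈ Tc '' K, ContinuousOn (fun t => ϕ t c) (Ici 0) := by
    intro c hc
    exact (isGalerkinODESolution_galerkinCoeffFlow hν.le hS hg (hK'V hc)).continuousOn
  have hY0 : ∀ᵐ c ∂μ', 0 ≤ Y c := ae_of_all _ fun c =>
    mul_nonneg (inv_nonneg.2 hT.le) (intervalIntegral.integral_nonneg hT.le fun t _ => he0 _)
  have hXY : ∀ᵐ c ∂μ', X c ≤ F * Real.sqrt (Y c) := by
    filter_upwards [hμ'K'] with c hc
    have hce : ContinuousOn (fun t => e (ϕ t c)) (Icc 0 T) :=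
      (he_cont.comp_continuousOn (horbit c hc)).mono Icc_subset_Ici_self
    have hcg : ContinuousOn (fun t => gpow (ϕ t c)) (Icc 0 T) :=
      (hg_cont.comp_continuousOn (horbit c hc)).mono Icc_subset_Ici_self
    have hle := intervalIntegral_le_sqrt_mul hF0 hT.le (hce.intervalIntegrable_of_Icc hT.le)
      (hcg.intervalIntegrable_of_Icc hT.le) (fun t _ => he0 _) (fun t _ => hg_le _)
    rw [hXdef, hYdef]
    simp only []
    have hTi : 0 < T⁻¹ := inv_pos.2 hT
    calc T⁻¹ * ∫ t in (0 : ℝ)..T, gpow (ϕ t c)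
        ≤ T⁻¹ * (F * Real.sqrt (T * ∫ t in (0 : ℝ)..T, e (ϕ t c))) := mul_le_mul_of_nonneg_left hle hTi.le
      _ = F * Real.sqrt (T⁻¹ * ∫ t in (0 : ℝ)..T, e (ϕ t c)) := by
          have hsT : Real.sqrt T ≠ 0 := (Real.sqrt_pos.2 hT).ne'
          rw [Real.sqrt_mul hT.le, Real.sqrt_mul hTi.le, Real.sqrt_inv]
          have hTinv : T⁻¹ = (Real.sqrt T)⁻¹ * (Real.sqrt T)⁻¹ := by
            rw [← mul_inv, Real.mul_self_sqrt hT.le]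
          rw [hTinv]
          field_simp
  -- the selection set: images of level-`N` classes in the absorbing ball
  set Sel : Set (↥(freqBall (d := Fin 3) N) → EuclideanSpace ℂ (Fin 3)) :=
    Tc '' (K ∩ {u : H3 | ‖u‖ ≤ Rν}) with hSel
  have hSel : ∀ᵐ c ∂μ', c ∈ Sel := by
    rw [hμ']
    refine (ae_map_iff hTc_meas.aemeasurable ?_).2 ?_
    · exact (hK.inter_right (isClosed_le continuous_norm continuous_const)).image hTc_cont
        |>.isClosed.measurableSet
    · filter_upwards [hμK, habs] with u hu hu'
      exact ⟨u, ⟨hu, hu'⟩, rfl⟩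
  -- select the datum
  obtain ⟨c, hcSel, hXc, hYc⟩ := exists_mem_of_integral_selection (μ := μ') (X := X) (Y := Y)
    (hXi.const_mul T⁻¹) (hYi.const_mul T⁻¹) hY0 hF0 hε' hM hXY hXint hYint hFE hSel
  obtain ⟨u, ⟨huK, huR⟩, rfl⟩ := hcSel
  have hcV := MomentParity.fourierRestrict_coe_mem_galerkinSubspace N u
  refine ⟨poly (Tc u), isGalerkinMode_realTrigPoly_coeffExt hcV, ?_, ?_, ?_, ?_⟩
  · -- zero mean: the mean mode of a level-`N` class vanishes
    refine hasZeroMean_realTrigPoly_of_coeff_zero' _ ?_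
    rw [Torus.coeffExt_of_mem _ (zero_mem_freqBall N), hTc]
    simp only [fourierRestrict_apply]
    exact huK.1 0 (by simp)
  · -- the absorbing ball
    change e (Tc u) ≤ Rν ^ 2
    rw [he_T u huK.1]
    have h0 : 0 ≤ ‖u‖ := norm_nonneg u
    have h1 : ‖u‖ ≤ Rν := huR
    nlinarith
  · -- window work
    have hflowpoly : ∀ t, Torus.galerkinFlow ν f N t (poly (Tc u)) = poly (ϕ t (Tc u)) := fun t =>
      Torus.galerkinFlow_realTrigPoly hcV t
    simp_rw [hflowpoly]
    have h1 : ε' / 2 ≤ X (Tc u) := hXc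
    have h2 : X (Tc u) = T⁻¹ * ∫ t in (0 : ℝ)..T, ∫ x, ⟪f x, poly (ϕ t (Tc u)) x⟫_ℝ := rfl
    rw [h2, le_inv_mul_iff₀ hT] at h1
    linarith
  · -- window energy
    have hflowpoly : ∀ t, Torus.galerkinFlow ν f N t (poly (Tc u)) = poly (ϕ t (Tc u)) := fun t =>
      Torus.galerkinFlow_realTrigPoly hcV t
    simp_rw [hflowpoly]
    have h1 : Y (Tc u) ≤ M := hYc
    have h2 : Y (Tc u) = T⁻¹ * ∫ t in (0 : ℝ)..T, ∫ x, ‖poly (ϕ t (Tc u)) x‖ ^ 2 := rfl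
    rw [h2, inv_mul_le_iff₀ hT] at h1
    linarith

end Summit.AnomalousDissipation.AnomalousDissipation.Theorems.MomentParityQuarticTightness

end
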